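import Summits.ValiantsHypothesis.ValiantsHypothesis.Theorems.LacunarySymmetroidMatrixDescartesPivotRankOneSharpNine

/-!
# `MatrixDescartes` census — rank-one `(2,4)₁`, `1|3` split: NINE ROOTS FORCE FIVE SEPARATED NEGATIVE WINDOWS
# (the formal entry point of the structural route: `Z₊ = 9 ⇒` five points with `det F < 0` separated by roots)

HONEST FRAMING.  Object-search cell `pub-symmetroid`, seat `val-sym-mdr-p1` (generation 17); helper file `--supports` the crux item
stmt-ValiantsHypothesis-18050 (`Theses.LacunarySymmetroid.MatrixDescartes`, OPEN, on HOLD) with NO closure claim.  Bookkeeping for the structural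
route to «rank-one (2,4)₁ = 8» (seat memo T-PROFILE.md): on the `1|3` split (`d₀ < e < d₁ < d₂ < d₃`, `J` real symmetric with `det J < 0`,
`w₀ > 0`, `w₁, w₂, w₃ ≥ 0`, the below-pivot letter core) a configuration with NINE distinct positive roots of `f = det F` would be Descartes-sharp,
hence (`…PivotRankOneSharpNine`) all nine roots are simple; here this is turned into the WINDOW STRUCTURE that a window-count theorem («at most four
negativity windows on the `1|3` split», OPEN) must exclude: five points `0 < x₀ < x₁ < x₂ < x₃ < x₄` with `f(xᵢ) < 0`, consecutive ones separated
by roots of `f`.  Nothing here bears on `MatrixDescartes` in its window, on `DoorA26` / `DoorA34`, registers / credences, or `VP ≠ VNP`; the rank-one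
register `{8, 9}` is unchanged.

* `prod_sub_parity` — for a multiset `m` of reals and `x < y` outside `m`: `(−1)^{#{a ∈ m : x < a < y}} · ∏(x − a) · ∏(y − a) > 0`.
* **`eval_mul_eval_parity`** (general, any real `f ≠ 0`) — for non-roots `x < y`: `(−1)^{#roots in (x,y), with multiplicity} · f(x) · f(y) > 0`
  (factor `f = ∏_{roots}(X − a) · q` with `q` root-free, `q` of constant sign by the intermediate value theorem).
* `card_roots_between_eq_two` — with the nine roots enumerated increasingly and simple, an interval straddling exactly two consecutive ones contains
  exactly two roots counted with multiplicity.
* **`rankOne_oneThree_nine_windows`** — the five separated negative points `x₀ < ρ₀ < x₁ < ρ₁ < … < x₄` (the first one from the letter-`0`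
  needle of `…PivotRankOneNullDirection`, the others by parity from it).

[folklore] `∏(X − a)`-factorisation (Mathlib `exists_prod_multiset_X_sub_C_mul`), intermediate value theorem, `Finset.orderEmbOfFin`.  No
definitions, no named facts.
-/

-- `Summit.ValiantsHypothesis.ValiantsHypothesis.…` repeats a component by the D-0017 layout
-- (single-conjunct summit), which the `dupNamespace` linter flags; the name is mandated.
set_option linter.dupNamespace false

namespace Summit.ValiantsHypothesis.ValiantsHypothesis.Theorems.LacunarySymmetroidMatrixDescartes.Pivot.NullDirection

open Polynomial Matrix Finset Set
open scoped BigOperators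

/-! ## 1. Parity of signs across roots (general real polynomials) -/

/-- For a multiset `m` of reals and `x < y` both outside `m`, the product `∏_{a∈m}(x − a) · ∏_{a∈m}(y − a)` has the sign `(−1)^{#{a ∈ m : x < a < y}}`.
[folklore] -/
theorem prod_sub_parity (m : Multiset ℝ) (x y : ℝ) (hxy : x < y) (hx : x ∉ m) (hy : y ∉ m) :
    0 < (-1 : ℝ) ^ (Multiset.card (m.filter (fun t => x < t ∧ t < y)))
      * ((m.map (fun a => x - a)).prod * (m.map (fun a => y - a)).prod) := by
  induction m using Multiset.induction_on with
  | empty => simp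
  | cons a m ih =>
    have hxa : x ≠ a := fun h => hx (h ▸ Multiset.mem_cons_self _ _)
    have hya : y ≠ a := fun h => hy (h ▸ Multiset.mem_cons_self _ _)
    have hx' : x ∉ m := fun h => hx (Multiset.mem_cons_of_mem h)
    have hy' : y ∉ m := fun h => hy (Multiset.mem_cons_of_mem h)
    have ih' := ih hx' hy'
    simp only [Multiset.map_cons, Multiset.prod_cons]
    by_cases hpa : x < a ∧ a < y
    · rw [Multiset.filter_cons_of_pos (p := fun t => x < t ∧ t < y) m hpa, Multiset.card_cons, pow_succ]
      have h1 : x - a < 0 := by linarith [hpa.1]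
      have h2 : 0 < y - a := by linarith [hpa.2]
      have key : (-1 : ℝ) ^ (Multiset.card (m.filter (fun t => x < t ∧ t < y))) * (-1)
          * ((x - a) * (m.map (fun a => x - a)).prod * ((y - a) * (m.map (fun a => y - a)).prod))
          = ((-1) * ((x - a) * (y - a))) * ((-1 : ℝ) ^ (Multiset.card (m.filter (fun t => x < t ∧ t < y)))
            * ((m.map (fun a => x - a)).prod * (m.map (fun a => y - a)).prod)) := by ring
      rw [key]
      exact mul_pos (by nlinarith [mul_neg_of_neg_of_pos h1 h2]) ih'
    · rw [Multiset.filter_cons_of_neg (p := fun t => x < t ∧ t < y) m hpa]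
      have hsame : 0 < (x - a) * (y - a) := by
        rcases lt_or_gt_of_ne hxa with h | h
        · -- `x < a`, so `a ≥ y` (as `¬ (x < a < y)`) and `a ≠ y`: both factors negative
          have hay : y < a := lt_of_le_of_ne (not_lt.1 fun h' => hpa ⟨h, h'⟩) hya
          nlinarith
        · nlinarith
      have key : (-1 : ℝ) ^ (Multiset.card (m.filter (fun t => x < t ∧ t < y)))
          * ((x - a) * (m.map (fun a => x - a)).prod * ((y - a) * (m.map (fun a => y - a)).prod))
          = ((x - a) * (y - a)) * ((-1 : ℝ) ^ (Multiset.card (m.filter (fun t => x < t ∧ t < y)))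
            * ((m.map (fun a => x - a)).prod * (m.map (fun a => y - a)).prod)) := by ring
      rw [key]
      exact mul_pos hsame ih'

/-- **Parity of the sign of `f` across its roots.**  For a real polynomial `f ≠ 0` and non-roots `x < y`:
`(−1)^{N} · f(x) · f(y) > 0`, where `N` is the number of roots of `f` in `(x, y)` counted with multiplicity.  (So `f(x)` and `f(y)` have the same
sign iff `N` is even.)  [folklore: `f = ∏(X − a)·q` with `q` free of real roots, hence of constant sign.] -/
theorem eval_mul_eval_parity (f : ℝ[X]) (hf : f ≠ 0) (x y : ℝ) (hxy : x < y) (hx : ¬ f.IsRoot x) (hy : ¬ f.IsRoot y) :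
    0 < (-1 : ℝ) ^ (Multiset.card (f.roots.filter (fun t => x < t ∧ t < y))) * (f.eval x * f.eval y) := by
  obtain ⟨q, hq, -, hqr⟩ := f.exists_prod_multiset_X_sub_C_mul
  have hq0 : q ≠ 0 := by
    intro h; rw [h, mul_zero] at hq; exact hf hq.symm
  have hqroot : ∀ z : ℝ, q.eval z ≠ 0 := by
    intro z hz
    have : z ∈ q.roots := (mem_roots hq0).2 hz
    rw [hqr] at this
    exact Multiset.notMem_zero _ this
  -- evaluation of the factorisation
  have hev : ∀ z : ℝ, f.eval z = (f.roots.map (fun a => z - a)).prod * q.eval z := by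
    intro z
    conv_lhs => rw [← hq]
    rw [eval_mul, eval_multiset_prod, Multiset.map_map]
    have hm : Multiset.map (eval z ∘ fun a => X - C a) f.roots = Multiset.map (fun a => z - a) f.roots :=
      Multiset.map_congr rfl fun a _ => by simp only [Function.comp_apply, eval_sub, eval_X, eval_C]
    rw [hm]
  -- `q` has constant sign on `[x, y]`
  have hqq : 0 < q.eval x * q.eval y := by
    rcases lt_trichotomy (q.eval x) 0 with h1 | h1 | h1
    · rcases lt_trichotomy (q.eval y) 0 with h2 | h2 | h2
      · exact mul_pos_of_neg_of_neg h1 h2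
      · exact absurd h2 (hqroot y)
      · exfalso
        have hc := intermediate_value_Icc hxy.le (q.continuous.continuousOn) (show (0 : ℝ) ∈ Icc (q.eval x) (q.eval y) from ⟨h1.le, h2.le⟩)
        obtain ⟨c, -, hc0⟩ := hc
        exact hqroot c hc0
    · exact absurd h1 (hqroot x)
    · rcases lt_trichotomy (q.eval y) 0 with h2 | h2 | h2
      · exfalso
        have hc := intermediate_value_Icc' hxy.le (q.continuous.continuousOn) (show (0 : ℝ) ∈ Icc (q.eval y) (q.eval x) from ⟨h2.le, h1.le⟩)
        obtain ⟨c, -, hc0⟩ := hc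
        exact hqroot c hc0
      · exact absurd h2 (hqroot y)
      · exact mul_pos h1 h2
  have hxm : x ∉ f.roots := fun h => hx ((mem_roots hf).1 h)
  have hym : y ∉ f.roots := fun h => hy ((mem_roots hf).1 h)
  have hpar := prod_sub_parity f.roots x y hxy hxm hym
  rw [hev x, hev y]
  have key : (-1 : ℝ) ^ (Multiset.card (f.roots.filter (fun t => x < t ∧ t < y)))
      * ((f.roots.map (fun a => x - a)).prod * q.eval x * ((f.roots.map (fun a => y - a)).prod * q.eval y))
      = ((-1 : ℝ) ^ (Multiset.card (f.roots.filter (fun t => x < t ∧ t < y)))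
        * ((f.roots.map (fun a => x - a)).prod * (f.roots.map (fun a => y - a)).prod)) * (q.eval x * q.eval y) := by ring
  rw [key]
  exact mul_pos hpar hqq

/-- Corollary: if `f(x) < 0` and the number of roots in `(x, y)` (with multiplicity) is even, then `f(y) < 0`. [folklore] -/
theorem eval_neg_of_even_roots_between (f : ℝ[X]) (hf : f ≠ 0) (x y : ℝ) (hxy : x < y) (hy : ¬ f.IsRoot y)
    (hfx : f.eval x < 0) (heven : Even (Multiset.card (f.roots.filter (fun t => x < t ∧ t < y)))) : f.eval y < 0 := by
  have hx : ¬ f.IsRoot x := fun h => by rw [IsRoot.def] at h; rw [h] at hfx; exact lt_irrefl _ hfx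
  have h := eval_mul_eval_parity f hf x y hxy hx hy
  rw [heven.neg_one_pow, one_mul] at h
  by_contra hc
  push Not at hc
  rcases hc.eq_or_lt with h0 | h0
  · exact hy h0.symm
  · nlinarith

/-! ## 2. Two consecutive simple roots in an interval -/

/-- If the positive roots of `f ≠ 0` are enumerated increasingly by `r : Fin n ↪o ℝ` (the order embedding of the finset of positive roots), all of
them simple, and `0 < u < v` are such that exactly the two consecutive roots `r j₀ < r j₁` (`j₁ = j₀ + 1`) lie in `(u, v)`, then `f` has exactly two
roots in `(u, v)` counted with multiplicity. [folklore] -/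
theorem card_roots_between_eq_two (f : ℝ[X]) (hf : f ≠ 0) {n : ℕ} (hn : (f.roots.toFinset.filter (fun t => 0 < t)).card = n)
    (hsimple : ∀ r : ℝ, 0 < r → f.IsRoot r → f.rootMultiplicity r = 1) (u v : ℝ) (hu : 0 < u) (j₀ j₁ : Fin n) (hj : (j₁ : ℕ) = j₀ + 1)
    (hin₀ : u < (f.roots.toFinset.filter (fun t => 0 < t)).orderEmbOfFin hn j₀)
    (hin₁ : (f.roots.toFinset.filter (fun t => 0 < t)).orderEmbOfFin hn j₁ < v)
    (hbelow : ∀ j : Fin n, (j : ℕ) < j₀ → (f.roots.toFinset.filter (fun t => 0 < t)).orderEmbOfFin hn j ≤ u)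
    (habove : ∀ j : Fin n, (j₁ : ℕ) < j → v ≤ (f.roots.toFinset.filter (fun t => 0 < t)).orderEmbOfFin hn j) :
    Multiset.card (f.roots.filter (fun t => u < t ∧ t < v)) = 2 := by
  classical
  set S := f.roots.toFinset.filter (fun t => 0 < t) with hS
  set r := S.orderEmbOfFin hn with hr
  have hne : j₀ ≠ j₁ := fun h => by rw [h] at hj; omega
  have hlt : r j₀ < r j₁ := r.strictMono (by rw [Fin.lt_def]; omega)
  -- the filtered multiset has no duplicates: every element is a positive root of multiplicity one
  set M := f.roots.filter (fun a => u < a ∧ a < v) with hM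
  have hMnodup : M.Nodup := by
    rw [Multiset.nodup_iff_count_le_one]
    intro a
    by_cases ha : a ∈ M
    · have ha' := Multiset.mem_filter.1 ha
      have hapos : 0 < a := hu.trans ha'.2.1
      rw [hM, Multiset.count_filter_of_pos (p := fun t => u < t ∧ t < v) ha'.2, count_roots,
        hsimple a hapos ((mem_roots hf).1 ha'.1)]
    · rw [Multiset.count_eq_zero_of_notMem ha]; omega
  rw [← Multiset.toFinset_card_of_nodup hMnodup]
  -- its support is exactly `{r j₀, r j₁}`
  have hset : M.toFinset = {r j₀, r j₁} := by
    ext a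
    rw [Multiset.mem_toFinset, hM, Multiset.mem_filter, Finset.mem_insert, Finset.mem_singleton]
    constructor
    · rintro ⟨haroot, hua, hav⟩
      have hapos : 0 < a := hu.trans hua
      have haS : a ∈ S := by
        rw [hS, Finset.mem_filter, Multiset.mem_toFinset]; exact ⟨haroot, hapos⟩
      have haS' : a ∈ Set.range r := by rw [hr, Finset.range_orderEmbOfFin]; exact haS
      obtain ⟨j, hja⟩ := haS'
      rw [← hja] at hua hav
      have h1 : ¬ ((j : ℕ) < j₀) := fun h => absurd (hbelow j h) (not_le.2 hua)
      have h2 : ¬ ((j₁ : ℕ) < j) := fun h => absurd (habove j h) (not_le.2 hav)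
      have : j = j₀ ∨ j = j₁ := by
        rcases Nat.lt_or_ge (j : ℕ) j₁ with h | h
        · left; ext; omega
        · right; ext; omega
      rcases this with h | h
      · left; rw [← hja, h]
      · right; rw [← hja, h]
    · rintro (h | h)
      · have hm : r j₀ ∈ S := by rw [hr]; exact Finset.orderEmbOfFin_mem _ _ _
        rw [hS, Finset.mem_filter, Multiset.mem_toFinset] at hm
        rw [h]; exact ⟨hm.1, hin₀, hlt.trans hin₁⟩
      · have hm : r j₁ ∈ S := by rw [hr]; exact Finset.orderEmbOfFin_mem _ _ _
        rw [hS, Finset.mem_filter, Multiset.mem_toFinset] at hm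
        rw [h]; exact ⟨hm.1, hin₀.trans hlt, hin₁⟩
  rw [hset, Finset.card_pair hlt.ne]

/-! ## 3. The five windows of a nine -/

set_option maxHeartbeats 400000 in
/-- **NINE ROOTS FORCE FIVE SEPARATED NEGATIVE WINDOWS.**  On the `1|3` split (`d₀ < e < d₁ < d₂ < d₃`), with `J` real symmetric, `det J < 0`,
`w₀ > 0`, `w₁, w₂, w₃ ≥ 0` and the below-pivot letter core (`m(J,v₀) < 0`): if `f = det F` has nine distinct positive roots, then there are points
`0 < x₀ < ρ₀ < x₁ < ρ₁ < x₂ < ρ₂ < x₃ < ρ₃ < x₄` with `f(xᵢ) < 0` and `f(ρᵢ) = 0` — five negativity windows of `f`, pairwise separated by roots.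
(A theorem «at most four windows on the `1|3` split» would therefore give `Z₊ ≤ 8` there; that count is OPEN.) [this file] -/
theorem rankOne_oneThree_nine_windows (e d₀ d₁ d₂ d₃ : ℕ) (h0e : d₀ < e) (he1 : e < d₁) (h12 : d₁ < d₂) (h23 : d₂ < d₃)
    (J : Matrix (Fin 2) (Fin 2) ℝ) (hJ : J 1 0 = J 0 1) (hdJ : J 0 0 * J 1 1 - J 0 1 ^ 2 < 0) (v₀ v₁ v₂ v₃ : Fin 2 → ℝ)
    (w₀ w₁ w₂ w₃ : ℝ) (hw₀ : 0 < w₀) (hw₁ : 0 ≤ w₁) (hw₂ : 0 ≤ w₂) (hw₃ : 0 ≤ w₃)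
    (hm₀ : J 0 0 * v₀ 1 ^ 2 + J 1 1 * v₀ 0 ^ 2 - (J 0 1 + J 1 0) * (v₀ 0 * v₀ 1) < 0)
    (hnine : ((Matrix.det (((X : ℝ[X]) ^ e) • J.map Polynomial.C
        + (Polynomial.C w₀ * X ^ d₀) • (vecMulVec v₀ v₀).map Polynomial.C
        + (Polynomial.C w₁ * X ^ d₁) • (vecMulVec v₁ v₁).map Polynomial.C
        + (Polynomial.C w₂ * X ^ d₂) • (vecMulVec v₂ v₂).map Polynomial.C
        + (Polynomial.C w₃ * X ^ d₃) • (vecMulVec v₃ v₃).map Polynomial.C)).roots.toFinset.filter (fun t => 0 < t)).card = 9) :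
    ∃ x₀ ρ₀ x₁ ρ₁ x₂ ρ₂ x₃ ρ₃ x₄ : ℝ,
      (0 < x₀ ∧ x₀ < ρ₀ ∧ ρ₀ < x₁ ∧ x₁ < ρ₁ ∧ ρ₁ < x₂ ∧ x₂ < ρ₂ ∧ ρ₂ < x₃ ∧ x₃ < ρ₃ ∧ ρ₃ < x₄) ∧
      (∀ y ∈ ({x₀, x₁, x₂, x₃, x₄} : Set ℝ), (Matrix.det (((X : ℝ[X]) ^ e) • J.map Polynomial.C
        + (Polynomial.C w₀ * X ^ d₀) • (vecMulVec v₀ v₀).map Polynomial.C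
        + (Polynomial.C w₁ * X ^ d₁) • (vecMulVec v₁ v₁).map Polynomial.C
        + (Polynomial.C w₂ * X ^ d₂) • (vecMulVec v₂ v₂).map Polynomial.C
        + (Polynomial.C w₃ * X ^ d₃) • (vecMulVec v₃ v₃).map Polynomial.C)).eval y < 0) ∧
      (∀ y ∈ ({ρ₀, ρ₁, ρ₂, ρ₃} : Set ℝ), (Matrix.det (((X : ℝ[X]) ^ e) • J.map Polynomial.C
        + (Polynomial.C w₀ * X ^ d₀) • (vecMulVec v₀ v₀).map Polynomial.C
        + (Polynomial.C w₁ * X ^ d₁) • (vecMulVec v₁ v₁).map Polynomial.C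
        + (Polynomial.C w₂ * X ^ d₂) • (vecMulVec v₂ v₂).map Polynomial.C
        + (Polynomial.C w₃ * X ^ d₃) • (vecMulVec v₃ v₃).map Polynomial.C)).IsRoot y) := by
  classical
  set f := Matrix.det (((X : ℝ[X]) ^ e) • J.map Polynomial.C
        + (Polynomial.C w₀ * X ^ d₀) • (vecMulVec v₀ v₀).map Polynomial.C
        + (Polynomial.C w₁ * X ^ d₁) • (vecMulVec v₁ v₁).map Polynomial.C
        + (Polynomial.C w₂ * X ^ d₂) • (vecMulVec v₂ v₂).map Polynomial.C
        + (Polynomial.C w₃ * X ^ d₃) • (vecMulVec v₃ v₃).map Polynomial.C) with hfdef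
  have hf0 : f ≠ 0 := by
    intro hz
    have : (f.roots.toFinset.filter (fun t => 0 < t)).card = 0 := by rw [hz]; simp
    omega
  set S := f.roots.toFinset.filter (fun t => 0 < t) with hS
  set r := S.orderEmbOfFin hnine with hr
  have hrS : ∀ j, r j ∈ S := fun j => Finset.orderEmbOfFin_mem _ _ _
  have hrpos : ∀ j, 0 < r j := fun j => (Finset.mem_filter.1 (hrS j)).2
  have hrroot : ∀ j, f.IsRoot (r j) := fun j => by
    have h := (Finset.mem_filter.1 (hrS j)).1
    rw [Multiset.mem_toFinset] at h
    exact (mem_roots hf0).1 h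
  have hmono : ∀ i j : Fin 9, (i : ℕ) < j → r i < r j := fun i j h => r.strictMono (Fin.lt_def.2 h)
  have hmonoLe : ∀ i j : Fin 9, (i : ℕ) ≤ j → r i ≤ r j := fun i j h => r.monotone (Fin.le_def.2 h)
  have hsimple : ∀ t : ℝ, 0 < t → f.IsRoot t → f.rootMultiplicity t = 1 := fun t ht htr =>
    (rankOne_oneThree_nine_simple e d₀ d₁ d₂ d₃ h0e he1 h12 h23 J v₀ v₁ v₂ v₃ w₀ w₁ w₂ w₃ hw₀ hw₁ hw₂ hw₃ hm₀ hnine t ht htr).1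
  -- the letter-0 needle: an explicit `x₂ > 0` below which `f < 0`
  set Q : ℝ := w₁ * (v₁ 0 * v₀ 1 - v₁ 1 * v₀ 0) ^ 2 + w₂ * (v₂ 0 * v₀ 1 - v₂ 1 * v₀ 0) ^ 2 + w₃ * (v₃ 0 * v₀ 1 - v₃ 1 * v₀ 0) ^ 2 with hQ
  have hQ0 : 0 ≤ Q := by rw [hQ]; positivity
  set m₀ : ℝ := J 0 0 * v₀ 1 ^ 2 - 2 * J 0 1 * (v₀ 1 * v₀ 0) + J 1 1 * v₀ 0 ^ 2 with hm₀def
  have hm₀neg : m₀ < 0 := by rw [hm₀def]; rw [hJ] at hm₀; linarith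
  set xn : ℝ := min 1 (-m₀ / (2 * (Q + 1))) with hxn
  have hxnpos : 0 < xn := lt_min one_pos (div_pos (by linarith) (by linarith))
  have hxnle1 : xn ≤ 1 := min_le_left _ _
  have hxnle : xn ≤ -m₀ / (2 * (Q + 1)) := min_le_right _ _
  have hneedle : ∀ x : ℝ, 0 < x → x ≤ xn → f.eval x < 0 := by
    intro x hx hxx
    refine eval_det_neg_below_of_perp e d₀ d₁ d₂ d₃ he1.le (by omega) (by omega) J hJ hdJ v₀ v₁ v₂ v₃ w₀ w₁ w₂ w₃ hw₀.le hw₁ hw₂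
      hw₃ xn ?_ x hx hxx
    have p1 : xn ^ (d₁ - e) ≤ xn := by
      calc xn ^ (d₁ - e) ≤ xn ^ 1 := pow_le_pow_of_le_one hxnpos.le hxnle1 (by omega)
        _ = xn := pow_one _
    have p2 : xn ^ (d₂ - e) ≤ xn := by
      calc xn ^ (d₂ - e) ≤ xn ^ 1 := pow_le_pow_of_le_one hxnpos.le hxnle1 (by omega)
        _ = xn := pow_one _
    have p3 : xn ^ (d₃ - e) ≤ xn := by
      calc xn ^ (d₃ - e) ≤ xn ^ 1 := pow_le_pow_of_le_one hxnpos.le hxnle1 (by omega)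
        _ = xn := pow_one _
    have t1 : 0 ≤ w₁ * (v₁ 0 * v₀ 1 - v₁ 1 * v₀ 0) ^ 2 := by positivity
    have t2 : 0 ≤ w₂ * (v₂ 0 * v₀ 1 - v₂ 1 * v₀ 0) ^ 2 := by positivity
    have t3 : 0 ≤ w₃ * (v₃ 0 * v₀ 1 - v₃ 1 * v₀ 0) ^ 2 := by positivity
    have q1 := mul_le_mul_of_nonneg_left p1 t1
    have q2 := mul_le_mul_of_nonneg_left p2 t2
    have q3 := mul_le_mul_of_nonneg_left p3 t3
    have e1 : w₁ * xn ^ (d₁ - e) * (v₁ 0 * v₀ 1 - v₁ 1 * v₀ 0) ^ 2 = w₁ * (v₁ 0 * v₀ 1 - v₁ 1 * v₀ 0) ^ 2 * xn ^ (d₁ - e) := by ring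
    have e2 : w₂ * xn ^ (d₂ - e) * (v₂ 0 * v₀ 1 - v₂ 1 * v₀ 0) ^ 2 = w₂ * (v₂ 0 * v₀ 1 - v₂ 1 * v₀ 0) ^ 2 * xn ^ (d₂ - e) := by ring
    have e3 : w₃ * xn ^ (d₃ - e) * (v₃ 0 * v₀ 1 - v₃ 1 * v₀ 0) ^ 2 = w₃ * (v₃ 0 * v₀ 1 - v₃ 1 * v₀ 0) ^ 2 * xn ^ (d₃ - e) := by ring
    have hQx2 : Q * xn = w₁ * (v₁ 0 * v₀ 1 - v₁ 1 * v₀ 0) ^ 2 * xn + w₂ * (v₂ 0 * v₀ 1 - v₂ 1 * v₀ 0) ^ 2 * xn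
        + w₃ * (v₃ 0 * v₀ 1 - v₃ 1 * v₀ 0) ^ 2 * xn := by rw [hQ]; ring
    have hsum : w₁ * xn ^ (d₁ - e) * (v₁ 0 * v₀ 1 - v₁ 1 * v₀ 0) ^ 2 + w₂ * xn ^ (d₂ - e) * (v₂ 0 * v₀ 1 - v₂ 1 * v₀ 0) ^ 2
        + w₃ * xn ^ (d₃ - e) * (v₃ 0 * v₀ 1 - v₃ 1 * v₀ 0) ^ 2 ≤ Q * xn := by
      rw [e1, e2, e3, hQx2]; linarith
    have hQx : Q * xn ≤ -m₀ / 2 := by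
      have h1 : Q * xn ≤ Q * (-m₀ / (2 * (Q + 1))) := mul_le_mul_of_nonneg_left hxnle hQ0
      have hQ1 : (0 : ℝ) < Q + 1 := by linarith
      have h3 : Q / (Q + 1) ≤ 1 := (div_le_one hQ1).2 (by linarith)
      have h4 : Q * (-m₀ / (2 * (Q + 1))) = (-m₀ / 2) * (Q / (Q + 1)) := by
        field_simp
      have h5 : (-m₀ / 2) * (Q / (Q + 1)) ≤ (-m₀ / 2) * 1 := mul_le_mul_of_nonneg_left h3 (by linarith)
      linarith
    have : J 0 0 * v₀ 1 ^ 2 - 2 * J 0 1 * (v₀ 1 * v₀ 0) + J 1 1 * v₀ 0 ^ 2 = m₀ := rfl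
    rw [this]
    linarith
  -- a point strictly between two consecutive enumerated roots is not a root
  have hnotroot : ∀ (y : ℝ) (j₀ j₁ : Fin 9), (j₁ : ℕ) = j₀ + 1 → r j₀ < y → y < r j₁ → ¬ f.IsRoot y := by
    intro y j₀ j₁ hj hy₀ hy₁ hyr
    have hypos : 0 < y := (hrpos j₀).trans hy₀
    have hyS : y ∈ S := by
      rw [hS, Finset.mem_filter, Multiset.mem_toFinset]; exact ⟨(mem_roots hf0).2 hyr, hypos⟩
    have hyS' : y ∈ Set.range r := by rw [hr, Finset.range_orderEmbOfFin]; exact hyS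
    obtain ⟨j, hjy⟩ := hyS'
    rw [← hjy] at hy₀ hy₁
    have h1 : (j₀ : ℕ) < j := by
      by_contra h
      exact absurd (hmonoLe j j₀ (not_lt.1 h)) (not_le.2 hy₀)
    have h2 : (j : ℕ) < j₁ := by
      by_contra h
      exact absurd (hmonoLe j₁ j (not_lt.1 h)) (not_le.2 hy₁)
    omega
  -- parity step: two simple roots between consecutive points keep the sign
  have step : ∀ (u v : ℝ) (j₀ j₁ : Fin 9), (j₁ : ℕ) = j₀ + 1 → 0 < u → u < v → f.eval u < 0 → ¬ f.IsRoot v →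
      u < r j₀ → r j₁ < v → (∀ j : Fin 9, (j : ℕ) < j₀ → r j ≤ u) → (∀ j : Fin 9, (j₁ : ℕ) < j → v ≤ r j) →
      f.eval v < 0 := by
    intro u v j₀ j₁ hj hu huv hfu hv hin₀ hin₁ hbelow habove
    refine eval_neg_of_even_roots_between f hf0 u v huv hv hfu ?_
    rw [card_roots_between_eq_two f hf0 hnine hsimple u v hu j₀ j₁ hj hin₀ hin₁ hbelow habove]
    exact ⟨1, rfl⟩
  have h01 := hmono 0 1 (by decide)
  have h12' := hmono 1 2 (by decide)
  have h23' := hmono 2 3 (by decide)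
  have h34 := hmono 3 4 (by decide)
  have h45 := hmono 4 5 (by decide)
  have h56 := hmono 5 6 (by decide)
  have h67 := hmono 6 7 (by decide)
  have h78 := hmono 7 8 (by decide)
  have hr0 := hrpos 0
  -- the five points and their negativity
  set x₀ : ℝ := min xn (r 0 / 2) with hx₀
  have hx₀pos : 0 < x₀ := lt_min hxnpos (by linarith)
  have hx₀lt : x₀ < r 0 := lt_of_le_of_lt (min_le_right _ _) (by linarith)
  have hx0neg : f.eval x₀ < 0 := hneedle _ hx₀pos (min_le_left _ _)
  have hx1neg : f.eval ((r 1 + r 2) / 2) < 0 := by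
    refine step x₀ _ 0 1 rfl hx₀pos (by linarith) hx0neg (hnotroot _ 1 2 rfl (by linarith) (by linarith)) hx₀lt (by linarith) ?_ ?_
    · intro j hj; change (j : ℕ) < 0 at hj; omega
    · intro j hj
      change 1 < (j : ℕ) at hj
      have := hmonoLe 2 j (by change 2 ≤ (j : ℕ); omega)
      linarith
  have hx2neg : f.eval ((r 3 + r 4) / 2) < 0 := by
    refine step ((r 1 + r 2) / 2) _ 2 3 rfl (by linarith [hrpos 1]) (by linarith) hx1neg
      (hnotroot _ 3 4 rfl (by linarith) (by linarith)) (by linarith) (by linarith) ?_ ?_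
    · intro j hj
      change (j : ℕ) < 2 at hj
      have := hmonoLe j 1 (by change (j : ℕ) ≤ 1; omega)
      linarith
    · intro j hj
      change 3 < (j : ℕ) at hj
      have := hmonoLe 4 j (by change 4 ≤ (j : ℕ); omega)
      linarith
  have hx3neg : f.eval ((r 5 + r 6) / 2) < 0 := by
    refine step ((r 3 + r 4) / 2) _ 4 5 rfl (by linarith [hrpos 3]) (by linarith) hx2neg
      (hnotroot _ 5 6 rfl (by linarith) (by linarith)) (by linarith) (by linarith) ?_ ?_
    · intro j hj
      change (j : ℕ) < 4 at hj
      have := hmonoLe j 3 (by change (j : ℕ) ≤ 3; omega)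
      linarith
    · intro j hj
      change 5 < (j : ℕ) at hj
      have := hmonoLe 6 j (by change 6 ≤ (j : ℕ); omega)
      linarith
  have hx4neg : f.eval ((r 7 + r 8) / 2) < 0 := by
    refine step ((r 5 + r 6) / 2) _ 6 7 rfl (by linarith [hrpos 5]) (by linarith) hx3neg
      (hnotroot _ 7 8 rfl (by linarith) (by linarith)) (by linarith) (by linarith) ?_ ?_
    · intro j hj
      change (j : ℕ) < 6 at hj
      have := hmonoLe j 5 (by change (j : ℕ) ≤ 5; omega)
      linarith
    · intro j hj
      change 7 < (j : ℕ) at hj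
      have := hmonoLe 8 j (by change 8 ≤ (j : ℕ); omega)
      linarith
  refine ⟨x₀, r 0, (r 1 + r 2) / 2, r 2, (r 3 + r 4) / 2, r 4, (r 5 + r 6) / 2, r 6, (r 7 + r 8) / 2,
    ⟨hx₀pos, hx₀lt, by linarith, by linarith, by linarith, by linarith, by linarith, by linarith, by linarith⟩, ?_, ?_⟩
  · intro y hy
    simp only [Set.mem_insert_iff, Set.mem_singleton_iff] at hy
    rcases hy with rfl | rfl | rfl | rfl | rfl
    · exact hx0neg
    · exact hx1neg
    · exact hx2neg
    · exact hx3neg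
    · exact hx4neg
  · intro y hy
    simp only [Set.mem_insert_iff, Set.mem_singleton_iff] at hy
    rcases hy with rfl | rfl | rfl | rfl
    · exact hrroot 0
    · exact hrroot 2
    · exact hrroot 4
    · exact hrroot 6

end Summit.ValiantsHypothesis.ValiantsHypothesis.Theorems.LacunarySymmetroidMatrixDescartes.Pivot.NullDirection
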